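import Summits.BirchSwinnertonDyer.Rank1Residual.O5.NoLocalThreeTorsionTransport
import Literature.NumberTheory.EllipticCurves.GoodReductionTorsionReductionProofs
import Literature.NumberTheory.EllipticCurves.LeadingTermTamagawaProofs
import HarnessLib

/-!
# O5 vocabulary at a GOOD prime `q ≠ 3` (and `NoLocalThreeTorsionAt` at every `ℓ`): the local predicates ARE
# statements about the reduction `W̃(𝔽_q)` / `m₀(ℓ)` (cell `b2b-bsdres`, lane CLASS-CLOSURE, class O5; harvest-2 GEN 58, E115)

HONEST FRAMING (cell `b2b-bsdres`, run/shared/lean/b2b/bsd-rank1-residual/, verbatim in every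
file): the goal of the cell is to DELETE the COMBINATION-SHAPED residual classes of the
Birch–Swinnerton-Dyer formula for ALL analytic-rank `≤ 1` elliptic curves over `ℚ` — "full BSD
formula for every rank `≤ 1` curve in class `C`" assembled STRICTLY from published theorems — so
that the rank-`≤ 1` remainder becomes exactly the CONSTRUCTION-SHAPED classes, which are TYPED
(missing-input `Prop`s), NOT attempted. This is not "finishing BSD". Lane CLASS-CLOSURE: research
routes; no claim beyond the stated classes; nothing is booked here; no mark of `RESIDUAL-MAP.md`
moves; census numbers are EVIDENCE. THEOREMS ONLY (no definition, no named fact, no conjecture node;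
net named-fact debt `0`); no node file is touched; O5 stays OPEN.

## What this file does

The O5 node files carry three census-decidable LOCAL predicates: `¬ FullLocalThreeTorsionAt C q` at
the level-raising prime `q ∤ N_C` of T-O5-JP♯ (`O5.SignedLevelRaisingTransferThreeSharp`,
`SharedSplitTransverseFree`, `AdditivePlacesFreeTransferThree`; docstring "with `C[3] ⊄ C(ℚ_q)` (cyclic
3-Sylow of `C̃(𝔽_q)`)"), the DIV bit `LocallyThreeDivisibleAt C q` / `PointLocallyThreeDivisibleAt C q P`
deciding the SIGN of T-O5-JP (docstring "`C(ℚ_q)/3 ≅ C̃(𝔽_q)/3` (formal group pro-`q`) …, so DIV is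
decided by the order of the reduced Mordell–Weil generators"), and `NoLocalThreeTorsionAt`
(`h⁰(ℚ_ℓ, W[3]) = 0`; also the T-O5-JP binders at `ℓ = 3`), whose meaning at additive `ℓ ≠ 3` (E111 §4),
at bad `ℓ ≠ 3` for the full-torsion variant (E113/E114) and along congruences (E111 §2–3) is in the
tree; the GOOD primes (and `ℓ = 3`) were the remaining cases. For `W/ℚ` globally minimal and elliptic,
`q ≠ 3` a prime with `q ∤ Δ_W`, and `W̃ = (integralModelInt W mod q)` (the curve whose points
`reductionPointCount W q` counts, tree `natCard_point_padicModel_residue`), the Literature proofs file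
`GoodReductionTorsionReductionProofs` gives Silverman *AEC* VII.3.1(b)/VII.2.1/IV.2.3 in the local
form `E(ℚ_q)[n] ≃+ W̃(𝔽_q)[n]`, `P ∈ nE(ℚ_q) ↔ P̃ ∈ nW̃(𝔽_q)` (`q ∤ n`). This file reads the predicates
through it (`n = 3`):

* §1 (finite abelian groups, [folklore]): "no element killed by a prime `ℓ`" is `ℓ ∤ #G`
  (Lagrange + Cauchy); two elements of order `3` with `Q ≠ ±P` force `9 ∣ #G`.
* §2 (good `q ≠ 3`): **`noLocalThreeTorsionAt_iff_not_three_dvd_reductionPointCount`**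
  (`NoLocalThreeTorsionAt W q ↔ 3 ∤ #W̃(𝔽_q)`, `= q + 1 − a_q`: `…_iff_not_three_dvd_frobenius`);
  **`fullLocalThreeTorsionAt_iff_exists_pair_reduction`** (`Full ↔ W̃(𝔽_q)` has two points of order
  `3` with `Q ≠ ±P`, via E111's `exists_pair_three_nsmul_iff_fullLocalThreeTorsionAt`), the census
  form `nine_dvd_reductionPointCount_of_fullLocalThreeTorsionAt` / `not_fullLocalThreeTorsionAt_of_not_nine_dvd`
  and, in the binders' OWN spelling `¬ q ∣ N_W` of "good at `q`", `…_of_not_dvd_conductorNorm`;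
  **`pointLocallyThreeDivisibleAt_iff_reduction`** / `locallyThreeDivisibleAt_iff_reduction` (DIV: a
  rational point is `3`-divisible in `C(ℚ_q)` iff its reduction is `3`-divisible in `C̃(𝔽_q)`).
* §3 (every prime `ℓ ≠ 3`, every reduction type): **`noLocalThreeTorsionAt_iff_not_three_dvd_formalIndex`**
  (`↔ 3 ∤ m₀(ℓ)`, `m₀(ℓ) = formalIndex W ℓ = [W(ℚ_ℓ) : E₁(ℚ_ℓ)] = c_ℓ · #Ẽ_ns(𝔽_ℓ)`, the KL3 / X11b
  Heegner-log normalisation constant; `formalIndex_eq_tamagawa_mul_reductionPointCount`,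
  `…_iff_not_three_dvd_tamagawa_mul_reductionPointCount`); and at every ODD prime, `ℓ = 3` INCLUDED, the
  sufficient half **`noLocalThreeTorsionAt_of_not_three_dvd_formalIndex`** (`E₁(ℚ_ℓ)` torsion-free for odd
  `ℓ`, Literature `eq_zero_of_isOfFinAddOrder_of_isInReductionKernel`) — the census test for the T-O5-JP
  binders `NoLocalThreeTorsionAt C 3` / `G 3`.

Nothing about any particular curve is asserted; no node is discharged; the census columns stay
EVIDENCE — this file only proves that the typed predicates are the statements about `#W̃(𝔽_q)`,
`W̃(𝔽_q)[3]`, `W̃(𝔽_q)/3` and `m₀(ℓ)` that the census computes.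

References: J. H. Silverman, *The Arithmetic of Elliptic Curves*, 2nd ed. (2009), IV.2.3, IV.6.1,
V.2.6, VII.2.1, VII.3.1, VII.6.1 [SilvermanAEC2009]; F. Diamond, J. Shurman, *A First Course in
Modular Forms* (2005), §8.3 [DiamondShurman2005]; cell: `O5/O5KummerLine.lean` §1,
`O5/O5UncleanParity.lean` §1, `O5/SignedLevelRaisingTransferThree.lean` §1/§3 (the predicates),
`O5/NoLocalThreeTorsionTransport.lean` (E111), HOME/b2b-bsdres-harvest-2/gen58/E115.

Design: no definitions (the reduced curve is written out as
`((integralModelInt W).map (Int.castRingHom ℤ_[q])).map (IsLocalRing.residue ℤ_[q])`, the reduction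
of a `ℚ_q`-point `P` as `reducePoint _ (Affine.Point.congrEquiv _ P)` along `padicModel_baseChange`, as
in the Literature file); `noncomputable section`; `open scoped Classical`. Axioms: `propext`,
`Classical.choice`, `Quot.sound`.
-/

set_option autoImplicit false
noncomputable section
open scoped Classical

namespace Summit.BirchSwinnertonDyer.Rank1Residual.O5

open WeierstrassCurve Literature.NumberTheory.EllipticCurves

namespace GoodReductionThree

/-! ## §1 Finite abelian groups: elements of order `3` -/

section Algebra

/-- In a finite abelian group, "no element of prime order `ℓ`" is `ℓ ∤ #G` (Lagrange and Cauchy).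
[folklore] -/
theorem forall_nsmul_eq_zero_iff_not_dvd_natCard {G : Type*} [AddCommGroup G] [Finite G]
    {ℓ : ℕ} (hℓ : ℓ.Prime) : (∀ g : G, ℓ • g = 0 → g = 0) ↔ ¬ ℓ ∣ Nat.card G := by
  haveI : Fact ℓ.Prime := ⟨hℓ⟩
  constructor
  · intro h hdvd
    obtain ⟨g, hg⟩ := exists_prime_addOrderOf_dvd_card' (G := G) ℓ hdvd
    have hg0 : ℓ • g = 0 := by rw [← hg]; exact addOrderOf_nsmul_eq_zero g
    have h1 : g = 0 := h g hg0
    rw [h1, addOrderOf_zero] at hg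
    exact hℓ.one_lt.ne hg
  · intro h g hg
    by_contra hg0
    have hdvd : addOrderOf g ∣ ℓ := addOrderOf_dvd_of_nsmul_eq_zero hg
    rcases (Nat.dvd_prime hℓ).mp hdvd with h1 | h3
    · exact hg0 (AddMonoid.addOrderOf_eq_one_iff.mp h1)
    · exact h (h3 ▸ addOrderOf_dvd_natCard g)

/-- `3 • P = 0`, `P ≠ 0`: the multiples of `P` are `0, P, -P`. [folklore] -/
theorem eq_of_mem_zmultiples_of_three_nsmul {G : Type*} [AddCommGroup G] {P Q : G}
    (hP : 3 • P = 0) (hQ : Q ∈ AddSubgroup.zmultiples P) : Q = 0 ∨ Q = P ∨ Q = -P := by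
  obtain ⟨k, rfl⟩ := AddSubgroup.mem_zmultiples_iff.mp hQ
  have h3 : (3 : ℤ) • P = 0 := by rw [show (3 : ℤ) = ((3 : ℕ) : ℤ) from rfl, natCast_zsmul, hP]
  have hk3 : k = 3 * (k / 3) + k % 3 := by omega
  have hk : k • P = (k % 3) • P := by
    conv_lhs => rw [hk3]
    rw [add_zsmul, mul_comm, mul_zsmul, h3, zsmul_zero, zero_add]
  have h0 : 0 ≤ k % 3 := Int.emod_nonneg k (by norm_num)
  have h1 : k % 3 < 3 := Int.emod_lt_of_pos k (by norm_num)
  rw [hk]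
  interval_cases (k % 3)
  · exact Or.inl (zero_zsmul P)
  · exact Or.inr (Or.inl (one_zsmul P))
  · refine Or.inr (Or.inr ?_)
    have h21 : (2 : ℤ) • P + P = 0 := by
      rw [← h3, show (3 : ℤ) = 2 + 1 by norm_num, add_zsmul, one_zsmul]
    exact eq_neg_of_add_eq_zero_left h21

/-- A non-zero element killed by `3` has order `3`. [folklore] -/
theorem addOrderOf_eq_three {G : Type*} [AddGroup G] {R : G} (hR0 : R ≠ 0) (hR : 3 • R = 0) :
    addOrderOf R = 3 := by
  rcases (Nat.dvd_prime Nat.prime_three).mp (addOrderOf_dvd_of_nsmul_eq_zero hR) with h1 | h3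
  · exact absurd (AddMonoid.addOrderOf_eq_one_iff.mp h1) hR0
  · exact h3

/-- **Two points of order `3` with `Q ≠ ±P` in a finite abelian group force `9 ∣ #G`**
(`#⟨P⟩ = 3` and the image of `Q` in `G/⟨P⟩` has order `3`). [folklore] -/
theorem nine_dvd_natCard_of_pair {G : Type*} [AddCommGroup G] [Finite G] {P Q : G}
    (hP0 : P ≠ 0) (hQ0 : Q ≠ 0) (hP : 3 • P = 0) (hQ : 3 • Q = 0) (hQP : Q ≠ P) (hQnP : Q ≠ -P) :
    9 ∣ Nat.card G := by
  set H := AddSubgroup.zmultiples P with hH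
  have hcardH : Nat.card H = 3 := by rw [hH, Nat.card_zmultiples, addOrderOf_eq_three hP0 hP]
  have hQmem : Q ∉ H := by
    intro hmem
    rcases eq_of_mem_zmultiples_of_three_nsmul hP hmem with h | h | h
    · exact hQ0 h
    · exact hQP h
    · exact hQnP h
  -- the image of `Q` in `G ⧸ H` is a non-zero `3`-torsion element
  have hQbar0 : (QuotientAddGroup.mk Q : G ⧸ H) ≠ 0 := by
    intro h
    exact hQmem ((QuotientAddGroup.eq_zero_iff Q).mp h)
  have hQbar3 : 3 • (QuotientAddGroup.mk Q : G ⧸ H) = 0 := by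
    rw [← QuotientAddGroup.mk_nsmul, hQ, QuotientAddGroup.mk_zero]
  have h3 : 3 ∣ Nat.card (G ⧸ H) := addOrderOf_eq_three hQbar0 hQbar3 ▸ addOrderOf_dvd_natCard _
  obtain ⟨m, hm⟩ := h3
  rw [H.card_eq_card_quotient_mul_card_addSubgroup, hcardH, hm]
  exact ⟨m, by ring⟩

end Algebra

/-! ## §2 The dictionaries at a good prime `q ≠ 3` -/

section Three

variable (W : WeierstrassCurve ℚ) [W.IsElliptic] [W.IsGloballyMinimal] (q : ℕ) [Fact q.Prime]

omit [W.IsElliptic] in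
/-- `W̃(𝔽_q)` is finite (of order `reductionPointCount W q > 0`, tree `natCard_point_padicModel_residue`). [folklore] -/
theorem finite_point_padicModel_residue :
    Finite (((integralModelInt W).map (Int.castRingHom ℤ_[q])).map
      (IsLocalRing.residue ℤ_[q])).toAffine.Point :=
  Nat.finite_of_card_ne_zero
    (by rw [W.natCard_point_padicModel_residue q]; exact (W.reductionPointCount_pos q).ne')

omit [W.IsElliptic] [W.IsGloballyMinimal] in
/-- `q ≠ 3` prime `⟹ q ∤ 3`. [folklore] -/
theorem not_dvd_three (hq3 : q ≠ 3) : ¬ q ∣ 3 := fun h ↦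
  hq3 ((Nat.prime_dvd_prime_iff_eq (Fact.out : q.Prime) Nat.prime_three).mp h)

omit [W.IsElliptic] in
/-- The two tree spellings of good reduction: `HasGoodReductionAtPrime q ⟹ q ∤ Δ_W`. [folklore] -/
theorem not_dvd_minimalDiscriminantInt_of_good (hgood : W.HasGoodReductionAtPrime q) :
    ¬ (q : ℤ) ∣ minimalDiscriminantInt W :=
  not_dvd_minimalDiscriminantInt_of_hasGoodReductionAtPrime' W q hgood

/-- **`NoLocalThreeTorsionAt W q ↔ W̃(𝔽_q)[3] = 0`** at a good prime `q ≠ 3`. [cite: SilvermanAEC2009, Prop. VII.3.1(b)] -/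
theorem noLocalThreeTorsionAt_iff_forall_reduction (hq3 : q ≠ 3)
    (hgood : ¬ (q : ℤ) ∣ minimalDiscriminantInt W) :
    NoLocalThreeTorsionAt W q ↔
      ∀ c : (((integralModelInt W).map (Int.castRingHom ℤ_[q])).map
        (IsLocalRing.residue ℤ_[q])).toAffine.Point, 3 • c = 0 → c = 0 := by
  rw [noLocalThreeTorsionAt_iff_forall_three_nsmul]
  exact forall_nsmul_eq_zero_iff_reduction hgood (not_dvd_three q hq3)

/-- **`NoLocalThreeTorsionAt W q ↔ 3 ∤ #W̃(𝔽_q) = reductionPointCount W q`** at a good prime `q ≠ 3` (the census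
reading "no `ℚ_q`-rational 3-torsion iff `3 ∤ #Ẽ(𝔽_q)`"). [cite: SilvermanAEC2009, Prop. VII.3.1(b) and Prop. VII.2.1] -/
theorem noLocalThreeTorsionAt_iff_not_three_dvd_reductionPointCount (hq3 : q ≠ 3)
    (hgood : ¬ (q : ℤ) ∣ minimalDiscriminantInt W) :
    NoLocalThreeTorsionAt W q ↔ ¬ 3 ∣ W.reductionPointCount q := by
  haveI := finite_point_padicModel_residue W q
  rw [noLocalThreeTorsionAt_iff_forall_reduction W q hq3 hgood,
    forall_nsmul_eq_zero_iff_not_dvd_natCard Nat.prime_three, W.natCard_point_padicModel_residue q]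

/-- The same in `a_q`-currency: **`NoLocalThreeTorsionAt W q ↔ 3 ∤ q + 1 − a_q(W)`**
(`a_q = frobeniusTrace W q = q + 1 − #W̃(𝔽_q)`). [cite: SilvermanAEC2009, Prop. VII.3.1(b) and Rem. V.2.6] -/
theorem noLocalThreeTorsionAt_iff_not_three_dvd_frobenius (hq3 : q ≠ 3)
    (hgood : ¬ (q : ℤ) ∣ minimalDiscriminantInt W) :
    NoLocalThreeTorsionAt W q ↔ ¬ (3 : ℤ) ∣ (q : ℤ) + 1 - W.frobeniusTrace q := by
  rw [noLocalThreeTorsionAt_iff_not_three_dvd_reductionPointCount W q hq3 hgood]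
  have h : (q : ℤ) + 1 - W.frobeniusTrace q = W.reductionPointCount q := by
    simp only [WeierstrassCurve.frobeniusTrace]; ring
  rw [h]
  exact (Int.natCast_dvd_natCast (m := 3)).not.symm

/-- Census form: `3 ∤ q + 1 − a_q ⟹ NoLocalThreeTorsionAt W q` at a good prime `q ≠ 3` (`HasGoodReductionAtPrime`
spelling; for `q = 3` see §3 `noLocalThreeTorsionAt_of_good_of_not_three_dvd_reductionPointCount`). [cite: SilvermanAEC2009, Prop. VII.3.1(b)] -/
theorem noLocalThreeTorsionAt_of_not_three_dvd_frobenius (hq3 : q ≠ 3)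
    (hgood : W.HasGoodReductionAtPrime q) (h : ¬ (3 : ℤ) ∣ (q : ℤ) + 1 - W.frobeniusTrace q) :
    NoLocalThreeTorsionAt W q :=
  (noLocalThreeTorsionAt_iff_not_three_dvd_frobenius W q hq3
    (not_dvd_minimalDiscriminantInt_of_good W q hgood)).mpr h

/-- **`FullLocalThreeTorsionAt W q ↔ W̃(𝔽_q)` has two points of order `3` with `Q ≠ ±P`** (`h⁰(ℚ_q, W[3]) = 2`
iff `W̃(𝔽_q)[3]` is not cyclic) at a good prime `q ≠ 3`: E111's point-level reading transported along
`E(ℚ_q)[3] ≃+ W̃(𝔽_q)[3]`. [cite: SilvermanAEC2009, Prop. VII.3.1(b) and VII.2.1; Exercise 3.7 (d),(f) for E111's `ψ₃` reading] -/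
theorem fullLocalThreeTorsionAt_iff_exists_pair_reduction (hq3 : q ≠ 3)
    (hgood : ¬ (q : ℤ) ∣ minimalDiscriminantInt W) :
    FullLocalThreeTorsionAt W q ↔
      ∃ P Q : (((integralModelInt W).map (Int.castRingHom ℤ_[q])).map
        (IsLocalRing.residue ℤ_[q])).toAffine.Point,
        P ≠ 0 ∧ Q ≠ 0 ∧ 3 • P = 0 ∧ 3 • Q = 0 ∧ Q ≠ P ∧ Q ≠ -P := by
  obtain ⟨e⟩ := nonempty_kerEquiv_reduction (W := W) (q := q) hgood (n := 3) (not_dvd_three q hq3)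
  rw [← exists_pair_three_nsmul_iff_fullLocalThreeTorsionAt]
  exact ⟨exists_pair_nsmul_of_kerEquiv (k := 3) e, exists_pair_nsmul_of_kerEquiv (k := 3) e.symm⟩

/-- **`FullLocalThreeTorsionAt W q ⟹ 9 ∣ #W̃(𝔽_q)`** at a good prime `q ≠ 3` (necessary condition,
census-usable by point count; with E112's `q ≡ 1 (mod 3)`). [cite: SilvermanAEC2009, Prop. VII.3.1(b)] -/
theorem nine_dvd_reductionPointCount_of_fullLocalThreeTorsionAt (hq3 : q ≠ 3)
    (hgood : ¬ (q : ℤ) ∣ minimalDiscriminantInt W) (hfull : FullLocalThreeTorsionAt W q) :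
    9 ∣ W.reductionPointCount q := by
  haveI := finite_point_padicModel_residue W q
  obtain ⟨P, Q, hP0, hQ0, hP, hQ, hQP, hQnP⟩ :=
    (fullLocalThreeTorsionAt_iff_exists_pair_reduction W q hq3 hgood).mp hfull
  rw [← W.natCard_point_padicModel_residue q]
  exact nine_dvd_natCard_of_pair hP0 hQ0 hP hQ hQP hQnP

/-- Census form: **`9 ∤ #W̃(𝔽_q) ⟹ ¬ FullLocalThreeTorsionAt W q`** at a good prime `q ≠ 3` (the binder of
T-O5-JP♯ at a level-raising prime with cyclic `3`-Sylow of `C̃(𝔽_q)`; `3 ∤ #` a fortiori). [cite: SilvermanAEC2009, Prop. VII.3.1(b)] -/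
theorem not_fullLocalThreeTorsionAt_of_not_nine_dvd (hq3 : q ≠ 3)
    (hgood : W.HasGoodReductionAtPrime q) (h9 : ¬ 9 ∣ W.reductionPointCount q) :
    ¬ FullLocalThreeTorsionAt W q := fun hfull ↦
  h9 (nine_dvd_reductionPointCount_of_fullLocalThreeTorsionAt W q hq3
    (not_dvd_minimalDiscriminantInt_of_good W q hgood) hfull)

/-- **DIV at a good prime `q ≠ 3`: a rational point `P` is `3`-divisible in `C(ℚ_q)` iff its reduction is
`3`-divisible in `C̃(𝔽_q)`** (`C(ℚ_q)/3 ≅ C̃(𝔽_q)/3`: the kernel of reduction is uniquely `3`-divisible) — the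
census reading of `PointLocallyThreeDivisibleAt`. [cite: SilvermanAEC2009, Prop. VII.2.1 and Prop. IV.2.3] -/
theorem pointLocallyThreeDivisibleAt_iff_reduction (hq3 : q ≠ 3)
    (hgood : ¬ (q : ℤ) ∣ minimalDiscriminantInt W) (P : (W.baseChange ℚ).toAffine.Point) :
    PointLocallyThreeDivisibleAt W q P ↔
      ∃ c : (((integralModelInt W).map (Int.castRingHom ℤ_[q])).map
        (IsLocalRing.residue ℤ_[q])).toAffine.Point,
        3 • c = reducePoint ((integralModelInt W).map (Int.castRingHom ℤ_[q]))
          (Affine.Point.congrEquiv (W.padicModel_baseChange q).symm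
            (Affine.Point.map (W' := W.toAffine) (Algebra.ofId ℚ ℚ_[q]) P)) := by
  rw [← exists_nsmul_eq_iff_reduction hgood (not_dvd_three q hq3)]
  unfold PointLocallyThreeDivisibleAt
  exact ⟨fun ⟨Q, hQ⟩ ↦ ⟨Q, hQ.symm⟩, fun ⟨Q, hQ⟩ ↦ ⟨Q, hQ.symm⟩⟩

/-- **`LocallyThreeDivisibleAt C q` read on the reduction**: every rational point reduces into
`3 · C̃(𝔽_q)`. [cite: SilvermanAEC2009, Prop. VII.2.1 and Prop. IV.2.3] -/
theorem locallyThreeDivisibleAt_iff_reduction (hq3 : q ≠ 3)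
    (hgood : ¬ (q : ℤ) ∣ minimalDiscriminantInt W) :
    LocallyThreeDivisibleAt W q ↔
      ∀ P : (W.baseChange ℚ).toAffine.Point,
        ∃ c : (((integralModelInt W).map (Int.castRingHom ℤ_[q])).map
          (IsLocalRing.residue ℤ_[q])).toAffine.Point,
          3 • c = reducePoint ((integralModelInt W).map (Int.castRingHom ℤ_[q]))
            (Affine.Point.congrEquiv (W.padicModel_baseChange q).symm
              (Affine.Point.map (W' := W.toAffine) (Algebra.ofId ℚ ℚ_[q]) P)) := by
  refine forall_congr' fun P ↦ ?_
  exact pointLocallyThreeDivisibleAt_iff_reduction W q hq3 hgood P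

/-! ### The binders' own currency `¬ q ∣ N_W` (T-O5-JP / JP♯ spell "good at `q`" as `¬ (q ∣ C.conductorNorm ℤ)`) -/

/-- `q ∤ N_W ⟹ q ∤ Δ_W^{min}` (`f_q = 0` iff good reduction, tree `dvd_conductorNorm_iff_not_hasGoodReductionAtPrime`),
so every theorem of this § applies under the binder `¬ q ∣ N_W`. [cite: DiamondShurman2005, §8.3 (PDF p. 353)] -/
theorem not_dvd_minimalDiscriminantInt_of_not_dvd_conductorNorm (hN : ¬ q ∣ W.conductorNorm ℤ) :
    ¬ (q : ℤ) ∣ minimalDiscriminantInt W :=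
  not_dvd_minimalDiscriminantInt_of_good W q
    (not_not.mp fun h ↦ hN ((dvd_conductorNorm_iff_not_hasGoodReductionAtPrime W q).mpr h))

/-- JP / JP♯ shape: `q ≠ 3`, `q ∤ N_W` ⟹ (`NoLocalThreeTorsionAt W q ↔ 3 ∤ #W̃(𝔽_q)`). [cite: SilvermanAEC2009, Prop. VII.3.1(b)] -/
theorem noLocalThreeTorsionAt_iff_of_not_dvd_conductorNorm (hq3 : q ≠ 3)
    (hN : ¬ q ∣ W.conductorNorm ℤ) : NoLocalThreeTorsionAt W q ↔ ¬ 3 ∣ W.reductionPointCount q :=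
  noLocalThreeTorsionAt_iff_not_three_dvd_reductionPointCount W q hq3
    (not_dvd_minimalDiscriminantInt_of_not_dvd_conductorNorm W q hN)

/-- The JP♯ / `SharedSplitTransverseFree` / `AdditivePlacesFreeTransferThree` binder `¬ FullLocalThreeTorsionAt C q`
at `q ∤ N_C`, `q ≠ 3`, from `9 ∤ #C̃(𝔽_q)` (cyclic or trivial `3`-Sylow). [cite: SilvermanAEC2009, Prop. VII.3.1(b)] -/
theorem not_fullLocalThreeTorsionAt_of_not_dvd_conductorNorm (hq3 : q ≠ 3)
    (hN : ¬ q ∣ W.conductorNorm ℤ) (h9 : ¬ 9 ∣ W.reductionPointCount q) :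
    ¬ FullLocalThreeTorsionAt W q := fun hfull ↦
  h9 (nine_dvd_reductionPointCount_of_fullLocalThreeTorsionAt W q hq3
    (not_dvd_minimalDiscriminantInt_of_not_dvd_conductorNorm W q hN) hfull)

end Three

/-! ## §3 Every `ℓ ≠ 3`: `NoLocalThreeTorsionAt W ℓ ↔ 3 ∤ m₀(ℓ) = c_ℓ·#Ẽ_ns(𝔽_ℓ)`; every ODD `ℓ` (`ℓ = 3` too): `3 ∤ m₀(ℓ) ⟹ NoLocal…` -/

section AnyReduction

variable (W : WeierstrassCurve ℚ) [W.IsElliptic] [W.IsGloballyMinimal] (ℓ : ℕ) [Fact ℓ.Prime]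

/-- **`m₀(ℓ) = formalIndex W ℓ = c_ℓ · N_ℓ`**, `N_ℓ = reductionPointCount W ℓ = #Ẽ_ns(𝔽_ℓ)` (`ℓ + 1 − a_ℓ` / `ℓ ∓ 1` / `ℓ`
at a good / split–non-split / additive prime): tree `index_formalFiltration`, `reduction_baseChange_eq`,
`natCard_point_padicModel_residue` (instance: `isMinimal_map_padic_of_isGloballyMinimal W ℓ`). [cite: SilvermanAEC2009, Prop. VII.2.1 and Thm. VII.6.1] -/
theorem formalIndex_eq_tamagawa_mul_reductionPointCount [(W.baseChange ℚ_[ℓ]).IsMinimal ℤ_[ℓ]] :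
    formalIndex W ℓ = (W.baseChange ℚ_[ℓ]).localTamagawaNumber ℤ_[ℓ] * W.reductionPointCount ℓ := by
  have key : ∀ (X : WeierstrassCurve ℚ_[ℓ]) [X.IsMinimal ℤ_[ℓ]],
      ((integralModelInt W).map (Int.castRingHom ℤ_[ℓ])).baseChange ℚ_[ℓ] = X →
        Nat.card (X.reduction ℤ_[ℓ]).toAffine.Point = W.reductionPointCount ℓ := by
    intro X _ hX
    subst hX
    rw [reduction_baseChange_eq]
    exact W.natCard_point_padicModel_residue ℓ
  rw [formalIndex, (W.baseChange ℚ_[ℓ]).index_formalFiltration le_rfl,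
    key (W.baseChange ℚ_[ℓ]) (W.padicModel_baseChange ℓ)]
  simp only [Nat.sub_self, pow_zero, mul_one]

/-- **`NoLocalThreeTorsionAt W ℓ ↔ 3 ∤ formalIndex W ℓ`** for EVERY prime `ℓ ≠ 3` and every
reduction type: `W(ℚ_ℓ)[3] ≅ (W(ℚ_ℓ)/E₁(ℚ_ℓ))[3]` (the kernel of reduction is uniquely
`3`-divisible, Literature `forall_nsmul_eq_zero_iff_quotient_formalFiltration`) and the quotient is a
finite group of order `formalIndex W ℓ = [W(ℚ_ℓ) : E₁(ℚ_ℓ)]` (the `m₀` of `PadicFormalLogOrder`). Good `ℓ`: `m₀ = #W̃(𝔽_ℓ)`;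
multiplicative: `c_ℓ (ℓ ∓ 1)`; additive: `ℓ c_ℓ` (test `3 ∤ c_ℓ`, as E111 §4). [cite: SilvermanAEC2009, Prop. VII.3.1(b), VII.2.1, VII.6.1] -/
theorem noLocalThreeTorsionAt_iff_not_three_dvd_formalIndex (hℓ3 : ℓ ≠ 3) :
    NoLocalThreeTorsionAt W ℓ ↔ ¬ 3 ∣ formalIndex W ℓ := by
  haveI : ((W.baseChange ℚ_[ℓ]).formalFiltration 1).FiniteIndex :=
    (W.baseChange ℚ_[ℓ]).finiteIndex_formalFiltration 1
  rw [noLocalThreeTorsionAt_iff_forall_three_nsmul,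
    (W.baseChange ℚ_[ℓ]).forall_nsmul_eq_zero_iff_quotient_formalFiltration (not_dvd_three ℓ hℓ3),
    forall_nsmul_eq_zero_iff_not_dvd_natCard Nat.prime_three, ← AddSubgroup.index_eq_card]
  rfl

/-- **`NoLocalThreeTorsionAt W ℓ ↔ 3 ∤ c_ℓ · N_ℓ`**, every prime `ℓ ≠ 3`, in the tree's `localTamagawaNumber` /
`reductionPointCount` currency — the "filtration test" as an equivalence.
[cite: SilvermanAEC2009, Prop. VII.3.1(b), VII.2.1, VII.6.1] -/
theorem noLocalThreeTorsionAt_iff_not_three_dvd_tamagawa_mul_reductionPointCount (hℓ3 : ℓ ≠ 3)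
    [(W.baseChange ℚ_[ℓ]).IsMinimal ℤ_[ℓ]] :
    NoLocalThreeTorsionAt W ℓ ↔
      ¬ 3 ∣ (W.baseChange ℚ_[ℓ]).localTamagawaNumber ℤ_[ℓ] * W.reductionPointCount ℓ := by
  rw [noLocalThreeTorsionAt_iff_not_three_dvd_formalIndex W ℓ hℓ3,
    formalIndex_eq_tamagawa_mul_reductionPointCount]

/-- **At every ODD prime, `ℓ = 3` INCLUDED: `3 ∤ m₀(ℓ) ⟹ NoLocalThreeTorsionAt W ℓ`.** `E₁(ℚ_ℓ)` is
torsion-free for `ℓ` odd (AEC IV.6.1: no `ℓ`-torsion since `v(ℓ) = 1 < ℓ − 1`; VII.3.1(a): none prime to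
`ℓ` — Literature `eq_zero_of_isOfFinAddOrder_of_isInReductionKernel`), so `W(ℚ_ℓ)[3] ↪ W(ℚ_ℓ)/E₁(ℚ_ℓ)`, a
group of order `m₀(ℓ)`. At `ℓ = 3`: the census-decidable SUFFICIENT condition for the T-O5-JP / JP♯ binders
`NoLocalThreeTorsionAt C 3` / `G 3` (good: `3 ∤ #C̃(𝔽₃)`; multiplicative: `3 ∤ 2c₃` / `3 ∤ 4c₃`); the converse can fail at `ℓ = 3`.
[cite: SilvermanAEC2009, Thm. IV.6.1, Prop. VII.2.1, Prop. VII.3.1] -/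
theorem noLocalThreeTorsionAt_of_not_three_dvd_formalIndex (hℓ2 : ℓ ≠ 2)
    (h : ¬ 3 ∣ formalIndex W ℓ) : NoLocalThreeTorsionAt W ℓ := by
  rw [noLocalThreeTorsionAt_iff_forall_three_nsmul]
  intro P hP
  have hmem : formalIndex W ℓ • P ∈ (W.baseChange ℚ_[ℓ]).formalFiltration 1 :=
    AddSubgroup.nsmul_index_mem _ P
  have hfin : IsOfFinAddOrder (formalIndex W ℓ • P) :=
    isOfFinAddOrder_iff_nsmul_eq_zero.mpr ⟨3, by norm_num, by rw [smul_comm, hP, nsmul_zero]⟩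
  have hzero : formalIndex W ℓ • P = 0 :=
    (W.baseChange ℚ_[ℓ]).eq_zero_of_isOfFinAddOrder_of_isInReductionKernel hℓ2 hmem.1 hfin
  have hdvd : addOrderOf P ∣ Nat.gcd 3 (formalIndex W ℓ) :=
    Nat.dvd_gcd (addOrderOf_dvd_of_nsmul_eq_zero hP) (addOrderOf_dvd_of_nsmul_eq_zero hzero)
  rw [(Nat.Coprime.gcd_eq_one ((Nat.Prime.coprime_iff_not_dvd Nat.prime_three).mpr h)),
    Nat.dvd_one] at hdvd
  exact AddMonoid.addOrderOf_eq_one_iff.mp hdvd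

/-- **`3 ∤ c_ℓ · reductionPointCount W ℓ ⟹ NoLocalThreeTorsionAt W ℓ`** at every odd prime `ℓ`, in particular
at `ℓ = 3`. [cite: SilvermanAEC2009, Thm. IV.6.1, Prop. VII.2.1, VII.3.1, VII.6.1] -/
theorem noLocalThreeTorsionAt_of_not_three_dvd_tamagawa_mul_reductionPointCount (hℓ2 : ℓ ≠ 2)
    [(W.baseChange ℚ_[ℓ]).IsMinimal ℤ_[ℓ]]
    (h : ¬ 3 ∣ (W.baseChange ℚ_[ℓ]).localTamagawaNumber ℤ_[ℓ] * W.reductionPointCount ℓ) :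
    NoLocalThreeTorsionAt W ℓ :=
  noLocalThreeTorsionAt_of_not_three_dvd_formalIndex W ℓ hℓ2
    (by rwa [formalIndex_eq_tamagawa_mul_reductionPointCount])

/-- At a GOOD odd prime, `ℓ = 3` included (`c_ℓ = 1`, tree `localTamagawaNumber_padic_eq_one_of_good_holds`):
**`3 ∤ #W̃(𝔽_ℓ) ⟹ NoLocalThreeTorsionAt W ℓ`** — the T-O5-JP binder `NoLocalThreeTorsionAt C 3` for `C` good at `3`
from ONE point count. [cite: SilvermanAEC2009, Thm. IV.6.1, Prop. VII.2.1 and the remark after it, Prop. VII.3.1] -/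
theorem noLocalThreeTorsionAt_of_good_of_not_three_dvd_reductionPointCount (hℓ2 : ℓ ≠ 2)
    (hgood : W.HasGoodReductionAtPrime ℓ) (h : ¬ 3 ∣ W.reductionPointCount ℓ) :
    NoLocalThreeTorsionAt W ℓ := by
  haveI : (W.baseChange ℚ_[ℓ]).IsMinimal ℤ_[ℓ] := isMinimal_map_padic_of_isGloballyMinimal W ℓ
  refine noLocalThreeTorsionAt_of_not_three_dvd_tamagawa_mul_reductionPointCount W ℓ hℓ2 ?_
  rwa [localTamagawaNumber_padic_eq_one_of_good_holds W ℓ hgood, one_mul]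

end AnyReduction

end GoodReductionThree

end Summit.BirchSwinnertonDyer.Rank1Residual.O5

end
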